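import Summits.CriticalPhenomena.PercolationContinuityZ3.Theorems.PercNearOneGluingNoHeavyQuantCornerTheorem
import HarnessLib

/-!
# QUANT lane R8, T-DEC: the EXPLICIT CORNER WITNESS (brick B1 of Theorem C, LEAD-NOTES-G23 N50 (3)) and scaling of flow witnesses

builds on p205010 (kernel theorem, internal audit signed; external expert review pending)

Support file (`--supports stmt-CriticalPhenomena-4575`), QUANT lane lead seat prim-quant-lead (gen 23), rung R8 of
`run/shared/lean/prim/quant/LADDER.md`.  One small definition (`cornerWitness`) and theorems; standard axioms, no sorries.
The typer's `flowAtT_of_cornerSucceeds` (…QuantCornerSound) hides its witness behind `∃`; Theorem C needs the witness BY NAME, because the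
corner identity (`cornerMidFlow_restrict`, …QuantCornerLayerRestrict) speaks about `cornerMidFlow`.  This file names it and re-proves the
typer's four clauses for it (proof transcribed from `flowAtT_of_cornerSucceeds`), plus two small tools.
* `cornerWitness x T j′ M μ` — the corner flow into the mids plus the leftovers split over the giants `∝ μ`;
* **`isFlowAtT_cornerWitness`** — `CornerSucceeds → IsFlowAtT x T j′ M μ (cornerWitness …)`;
* `cornerWitness_of_le` — on the columns `h ≤ j′` the witness IS `cornerMidFlow`;
* `IsFlowAtT.smul` — positive multiples of a witness are witnesses of the multiple law.

[this work]; nothing here is cited as a published result.  The gluing rows served [cite: KozmaNitzan2024, Conjecture 3 (p. 15)]; product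
measure [cite: Grimmett1999, §1.3 p. 10].
-/

noncomputable section

namespace Summit.CriticalPhenomena.PercolationContinuityZ3.Theorems

namespace Quant

open Finset

namespace LawDec

section Witness

variable (x T : ℝ) (j' M : ℕ) (μ : ℕ → ℝ)

/-- **the corner witness**: corner flow into the mids, leftovers split over the giants proportionally to their masses. [this work] -/
def cornerWitness (x T : ℝ) (j' M : ℕ) (μ : ℕ → ℝ) : ℕ → ℕ → ℝ := fun a b =>
  cornerMidFlow x T j' M μ a b
    + (if (∑ h ∈ Finset.Ico (j' + 1) (M + 1), μ h) = 0 then (0:ℝ) else 1 / ∑ h ∈ Finset.Ico (j' + 1) (M + 1), μ h)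
      * (if a ≤ j' ∧ 2 * (a : ℝ) < T then cornerLeftover x T j' M μ a else 0) * (if j' + 1 ≤ b ∧ b ≤ M then μ b else 0)

/-- on the columns `≤ j′` the corner witness is the corner flow. -/
theorem cornerWitness_of_le (a b : ℕ) (hb : b ≤ j') : cornerWitness x T j' M μ a b = cornerMidFlow x T j' M μ a b := by
  unfold cornerWitness
  rw [if_neg (show ¬ (j' + 1 ≤ b ∧ b ≤ M) from fun h => by omega), mul_zero, add_zero]

/-- **THE CORNER WITNESS IS A WITNESS** when the corner run succeeds (`0 < x < 1`, nonnegative law).  Transcription of the typer's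
`flowAtT_of_cornerSucceeds` with the witness named. [this work] -/
theorem isFlowAtT_cornerWitness (hx0 : 0 < x) (hx1 : x < 1) (hμ : ∀ k, 0 ≤ μ k) (hC : CornerSucceeds x T j' M μ) :
    IsFlowAtT x T j' M μ (cornerWitness x T j' M μ) := by
  obtain ⟨h0, hsup, hrow, hcol⟩ := cornerFlow_inv x T j' M μ hx0 hx1 hμ ((j' + 1) * (j' + 1)) le_rfl
  unfold CornerSucceeds at hC
  unfold cornerWitness
  generalize hS : ∑ l ∈ (Finset.range (j' + 1)).filter (fun l : ℕ => 2 * (l : ℝ) < T), cornerLeftover x T j' M μ l = S at hC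
  generalize hG : ∑ h ∈ Finset.Ico (j' + 1) (M + 1), μ h = G at hC
  have h1x : 0 < 1 - x := by linarith
  have hxr : 0 < x / (1 - x) := div_pos hx0 h1x
  have hleft0 : ∀ l, 0 ≤ cornerLeftover x T j' M μ l := by
    intro l; unfold cornerLeftover cornerMidFlow; linarith [hrow l]
  have hS0 : 0 ≤ S := by rw [← hS]; exact Finset.sum_nonneg (fun l _ => hleft0 l)
  have hG0 : 0 ≤ G := by rw [← hG]; exact Finset.sum_nonneg (fun h _ => hμ h)
  have hc0 : 0 ≤ (if G = 0 then (0:ℝ) else 1 / G) := by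
    split_ifs
    · exact le_rfl
    · exact div_nonneg zero_le_one hG0
  have hL0 : ∀ a, 0 ≤ (if a ≤ j' ∧ 2 * (a : ℝ) < T then cornerLeftover x T j' M μ a else 0) := by
    intro a; split_ifs
    · exact hleft0 a
    · exact le_rfl
  have hW0 : ∀ b, 0 ≤ (if j' + 1 ≤ b ∧ b ≤ M then μ b else 0) := by
    intro b; split_ifs
    · exact hμ b
    · exact le_rfl
  refine ⟨?_, ?_, ?_, ?_⟩
  · intro a b
    have hF := h0 a b
    have := mul_nonneg (mul_nonneg hc0 (hL0 a)) (hW0 b)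
    unfold cornerMidFlow
    linarith
  · intro a b hpos
    dsimp only at hpos
    by_cases hF : cornerMidFlow x T j' M μ a b = 0
    · rw [hF, zero_add] at hpos
      have hlow : a ≤ j' ∧ 2 * (a : ℝ) < T := by
        by_contra hn; rw [if_neg hn, mul_zero, zero_mul] at hpos; exact lt_irrefl _ hpos
      have hgiant : j' + 1 ≤ b ∧ b ≤ M := by
        by_contra hn; rw [if_neg hn, mul_zero] at hpos; exact lt_irrefl _ hpos
      exact ⟨hlow.1, hlow.2, hgiant.2, Or.inl hgiant.1⟩
    · obtain ⟨h1, -, h3, h4, h5, -⟩ := hsup a b hF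
      exact ⟨h1, h3, h4, Or.inr h5⟩
  · intro a haj halow
    dsimp only
    rw [Finset.sum_add_distrib, ← Finset.mul_sum, if_pos (show a ≤ j' ∧ 2 * (a : ℝ) < T from ⟨haj, halow⟩),
      sum_range_ite_giant j' M μ, hG]
    have hFa : ∑ b ∈ Finset.range (M + 1), cornerMidFlow x T j' M μ a b = μ a - cornerLeftover x T j' M μ a := by
      unfold cornerLeftover; ring
    rw [hFa]
    by_cases hG0' : G = 0
    · rw [if_pos hG0']
      have hS0' : S = 0 := by
        rw [hG0'] at hC
        have : x / (1 - x) * S ≤ 0 := hC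
        nlinarith
      have hmem : a ∈ (Finset.range (j' + 1)).filter (fun l : ℕ => 2 * (l : ℝ) < T) :=
        Finset.mem_filter.2 ⟨Finset.mem_range.2 (by omega), halow⟩
      have hz := (Finset.sum_eq_zero_iff_of_nonneg (fun l _ => hleft0 l)).1 (hS.trans hS0') a hmem
      rw [hz]; ring
    · rw [if_neg hG0']
      field_simp
      ring
  · intro b hbM hself
    dsimp only
    have e : ∀ a, usage x T j' a b * (cornerMidFlow x T j' M μ a b
        + (if G = 0 then (0:ℝ) else 1 / G) * (if a ≤ j' ∧ 2 * (a : ℝ) < T then cornerLeftover x T j' M μ a else 0)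
          * (if j' + 1 ≤ b ∧ b ≤ M then μ b else 0))
        = usage x T j' a b * cornerMidFlow x T j' M μ a b
          + ((if G = 0 then (0:ℝ) else 1 / G) * (if j' + 1 ≤ b ∧ b ≤ M then μ b else 0))
            * (usage x T j' a b * (if a ≤ j' ∧ 2 * (a : ℝ) < T then cornerLeftover x T j' M μ a else 0)) :=
      fun a => by ring
    simp only [e, Finset.sum_add_distrib]
    rw [← Finset.mul_sum]
    by_cases hgb : j' + 1 ≤ b
    · have hFz : ∀ a, usage x T j' a b * cornerMidFlow x T j' M μ a b = 0 := by
        intro a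
        by_cases hF : cornerMidFlow x T j' M μ a b = 0
        · rw [hF, mul_zero]
        · have := (hsup a b hF).2.1; omega
      have hug : ∀ a ∈ Finset.range (j' + 1),
          usage x T j' a b * (if a ≤ j' ∧ 2 * (a : ℝ) < T then cornerLeftover x T j' M μ a else 0)
            = x / (1 - x) * (if a ≤ j' ∧ 2 * (a : ℝ) < T then cornerLeftover x T j' M μ a else 0) := by
        intro a _; rw [usage_giant_eq x T j' a b hgb]
      rw [Finset.sum_congr rfl (fun a _ => hFz a), Finset.sum_const_zero, zero_add, Finset.sum_congr rfl hug,
        ← Finset.mul_sum, sum_range_ite_low T j', hS, if_pos (show j' + 1 ≤ b ∧ b ≤ M from ⟨hgb, hbM⟩)]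
      by_cases hG0' : G = 0
      · rw [if_pos hG0']; simp only [zero_mul]; exact hμ b
      · rw [if_neg hG0']
        have hGp : 0 < G := lt_of_le_of_ne hG0 (Ne.symm hG0')
        rw [show 1 / G * μ b * (x / (1 - x) * S) = μ b * ((x / (1 - x) * S) / G) by ring]
        have hfrac : (x / (1 - x) * S) / G ≤ 1 := by rw [div_le_one hGp]; exact hC
        nlinarith [hμ b]
    · have hng : ¬ (j' + 1 ≤ b ∧ b ≤ M) := fun hn => hgb hn.1
      rw [if_neg hng]
      simp only [mul_zero, zero_mul, add_zero]
      exact hcol b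

/-- **positive multiples of a witness are witnesses of the multiple law.** [this work] -/
theorem IsFlowAtT.smul {x T : ℝ} {j' M : ℕ} {μ : ℕ → ℝ} {f : ℕ → ℕ → ℝ} (hF : IsFlowAtT x T j' M μ f)
    (c : ℝ) (hc : 0 ≤ c) : IsFlowAtT x T j' M (fun k => c * μ k) (fun l h => c * f l h) := by
  refine ⟨fun l h => mul_nonneg hc (hF.1 l h), ?_, ?_, ?_⟩
  · intro l h hp
    have : 0 < f l h := by
      by_contra hle
      have := mul_nonpos_iff.2 (Or.inl ⟨hc, not_lt.1 hle⟩)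
      exact absurd hp (not_lt.2 this)
    exact hF.2.1 l h this
  · intro l hl hlow
    show ∑ h ∈ Finset.range (M + 1), c * f l h = c * μ l
    rw [← Finset.mul_sum, hF.2.2.1 l hl hlow]
  · intro h hhM hc'
    show ∑ l ∈ Finset.range (j' + 1), usage x T j' l h * (c * f l h) ≤ c * μ h
    have e : ∑ l ∈ Finset.range (j' + 1), usage x T j' l h * (c * f l h)
        = c * ∑ l ∈ Finset.range (j' + 1), usage x T j' l h * f l h := by
      rw [Finset.mul_sum]; exact Finset.sum_congr rfl fun l _ => by ring
    rw [e]
    exact mul_le_mul_of_nonneg_left (hF.2.2.2 h hhM hc') hc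

end Witness

end LawDec

end Quant

end Summit.CriticalPhenomena.PercolationContinuityZ3.Theorems
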